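import Summits.MatrixMultiplication.MatrixMultiplication.Theorems.SoloBlindTwist

/-!
# GE2 is Conjecture E on the one-step twists

Sub-programme (K₃), continuation of `SoloBlindTwist`.  There, (K₃) + GE2 on `S` gave Conjecture E on every twist
`S ∪ {b, b + a}` (`soloBlind_twist_conjE`).  Here the converse bookkeeping: a target `(σ, 1)` of the twist along
`a` is H-good AS SOON AS no sub-sum of `S` equals `σ + (σ - a)` (`soloBlind_twist_hgood_one`, converse of
`soloBlind_twist_pair_free`), so CONJECTURE E ON THE TWISTS OF `S` (all shifts `a`, all H-good targets `(σ, 1)`)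
IMPLIES GE2 ON `S` (`soloBlind_ge2_of_twist_conjE`): take `a = t₁ - t₂`, `σ = t₁`, and read
`K((σ,1); S*) = (K(t₁; S) + K(t₂; S)) / 2 ≤ 1/2`.  Together with the cone lift (`soloBlind_kraft_of_conjE`:
E one rank up gives (K₃)) this places the cross inequality GE2 exactly: it is the part of Conjecture E one rank
up that lives on twists, and (K₃) ∧ GE2 in rank `r` is EQUIVALENT to E on the cones and twists of rank-`r`
configurations.
-/

namespace Summit.MatrixMultiplication.MatrixMultiplication.Theorems

open Finset

universe u v

variable {ι : Type v} [DecidableEq ι]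
variable {G : Type u} [AddCommGroup G] [DecidableEq G]

omit [DecidableEq G] in
/-- Full sub-sum formula for the twist: apex part, `q`-part and the flat part. -/
theorem soloBlind_twist_sum (h : ι → G) (a : G) (T : Finset (Option (Option ι))) :
    ∑ o ∈ T, soloBlindTwist h a o =
      (if none ∈ T then ((0, 1) : G × ZMod 3) else 0) +
        ((if none ∈ eraseNone T then ((a, 1) : G × ZMod 3) else 0) +
          ((∑ i ∈ eraseNone (eraseNone T), h i, 0) : G × ZMod 3)) := by
  rw [soloBlindTwist, soloBlind_adjoin_sum, soloBlind_adjoin_sum, soloBlind_flat_sum]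

omit [DecidableEq G] in
/-- H-GOODNESS OF `(σ, 1)` FROM PAIR-FREENESS: if no sub-sum of `S` equals `σ + (σ - a)` then `(σ, 1)` is H-good on
the twist along `a` (a sub-sum with second coordinate `1 + 1` contains both new points, and then its flat part sums
to `σ + σ - a`). -/
theorem soloBlind_twist_hgood_one (h : ι → G) (S : Finset ι) (a σ : G)
    (hfree : ∀ T ⊆ S, ∑ i ∈ T, h i ≠ σ + (σ - a)) :
    ∀ T ⊆ insertNone (insertNone S),
      ∑ o ∈ T, soloBlindTwist h a o ≠ ((σ, 1) : G × ZMod 3) + (σ, 1) := by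
  intro T hT hsum
  rw [soloBlind_twist_sum, Prod.mk_add_mk] at hsum
  have hV : eraseNone (eraseNone T) ⊆ S := by
    intro i hi
    have hi2 : some (some i) ∈ T := mem_eraseNone.mp (mem_eraseNone.mp hi)
    exact some_mem_insertNone.mp (some_mem_insertNone.mp (hT hi2))
  have h2 := congrArg Prod.snd hsum
  have h1 := congrArg Prod.fst hsum
  by_cases hp : none ∈ T
  · by_cases hq : none ∈ eraseNone T
    · rw [if_pos hp, if_pos hq] at h1
      change (0 : G) + (a + ∑ i ∈ eraseNone (eraseNone T), h i) = σ + σ at h1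
      refine hfree _ hV ?_
      have : ∑ i ∈ eraseNone (eraseNone T), h i - (σ + (σ - a)) =
          0 + (a + ∑ i ∈ eraseNone (eraseNone T), h i) - (σ + σ) := by abel
      rw [h1, sub_self] at this
      exact sub_eq_zero.mp this
    · rw [if_pos hp, if_neg hq] at h2
      change (1 : ZMod 3) + (0 + 0) = 1 + 1 at h2
      exact absurd h2 (by decide)
  · by_cases hq : none ∈ eraseNone T
    · rw [if_neg hp, if_pos hq] at h2
      change (0 : ZMod 3) + (1 + 0) = 1 + 1 at h2
      exact absurd h2 (by decide)
    · rw [if_neg hp, if_neg hq] at h2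
      change (0 : ZMod 3) + (0 + 0) = 1 + 1 at h2
      exact absurd h2 (by decide)

/-- GE2 FROM CONJECTURE E ON THE TWISTS.  If for every shift `a` and every `σ` the twist of `S` along `a` satisfies
`K((σ,1); S*) ≤ 1/2` whenever `(σ, 1)` is H-good, then `S` satisfies GE2: `K(t₁; S) + K(t₂; S) ≤ 1` whenever no
sub-sum of `S` equals `t₁ + t₂`. -/
theorem soloBlind_ge2_of_twist_conjE (h : ι → G) (S : Finset ι)
    (hE : ∀ a σ : G, (∀ T ⊆ insertNone (insertNone S),
        ∑ o ∈ T, soloBlindTwist h a o ≠ ((σ, 1) : G × ZMod 3) + (σ, 1)) →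
      soloBlindMass (soloBlindTwist h a) (insertNone (insertNone S)) ((σ, 1) : G × ZMod 3) ≤ 1 / 2)
    (t₁ t₂ : G) (hfree : ∀ T ⊆ S, ∑ i ∈ T, h i ≠ t₁ + t₂) :
    soloBlindMass h S t₁ + soloBlindMass h S t₂ ≤ 1 := by
  have ht : t₁ - (t₁ - t₂) = t₂ := sub_sub_cancel t₁ t₂
  have hfree' : ∀ T ⊆ S, ∑ i ∈ T, h i ≠ t₁ + (t₁ - (t₁ - t₂)) := by
    rw [ht]
    exact hfree
  have := hE (t₁ - t₂) t₁ (soloBlind_twist_hgood_one h S (t₁ - t₂) t₁ hfree')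
  rw [soloBlind_twist_mass_one, ht] at this
  linarith

/-- THE EXACT PLACEMENT OF GE2 (one configuration, all shifts): `S` satisfies (K₃) ∧ GE2 if and only if (K₃) holds
on `S` and Conjecture E holds at every H-good target `(σ, 1)` of every one-step twist of `S`. -/
theorem soloBlind_ge2_iff_twist_conjE (h : ι → G) (S : Finset ι) (hK : ∀ σ : G, soloBlindMass h S σ ≤ 1) :
    (∀ t₁ t₂ : G, (∀ T ⊆ S, ∑ i ∈ T, h i ≠ t₁ + t₂) →
        soloBlindMass h S t₁ + soloBlindMass h S t₂ ≤ 1) ↔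
      (∀ a σ : G, (∀ T ⊆ insertNone (insertNone S),
          ∑ o ∈ T, soloBlindTwist h a o ≠ ((σ, 1) : G × ZMod 3) + (σ, 1)) →
        soloBlindMass (soloBlindTwist h a) (insertNone (insertNone S)) ((σ, 1) : G × ZMod 3) ≤ 1 / 2) := by
  constructor
  · intro hGE2 a σ hgood
    exact soloBlind_twist_conjE h S a hK hGE2 (σ, 1) hgood
  · intro hE
    exact soloBlind_ge2_of_twist_conjE h S hE

end Summit.MatrixMultiplication.MatrixMultiplication.Theorems
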